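import Literature.AlgebraicGeometry.Resolution.MarkedIdealPointBlowup
import HarnessLib

/-!
# Order reduction for marked ideals on regular one-dimensional schemes (every characteristic)

Topic: `Literature/AlgebraicGeometry/Resolution`. The base of the dimension induction of the
characteristic-zero algorithm (J. Kollár, *Lectures on Resolution of Singularities* (2007),
Thm. 3.69 order reduction for marked ideals, proved by induction on `dim X` (3.70); E. Bierstone,
D. Grigoriev, P. Milman, J. Włodarczyk, arXiv:1206.3090, Def. 3.1.3 resolution of a marked ideal
`(X, 𝓘, E, μ)`) in dimension ONE, where no derivative enters and the statement is
characteristic-free: blowing up the closed points of the support one at a time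
(`MarkedIdealPointBlowup.lean`: each such blowing up is an isomorphism lowering the order at the
blown-up point by `μ`) terminates after at most `Σ_{x ∈ supp} ord_x 𝓘` steps with empty support —
Kollár's 3.111 Step 1 in dimension one, where every component of the cosupport has codimension one.

* `sum_idealOrder_transform_point_lt` — **termination measure**: `Σ_{z ∈ supp} ord_z 𝓘` strictly
  decreases along the blowing up of a point of the support;
* **`exists_isResolutionOf_of_dim_one`**, `exists_isResolutionOf_of_ringKrullDim_le_one` — order
  reduction in dimension one: on a locally Noetherian scheme, a marked ideal `(X, 𝓘, E, μ)` with
  `μ ≥ 1`, `E` a simple normal crossing boundary, FINITE support consisting of closed points at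
  which `𝔪_x` is principal (resp. `dim 𝒪_{X,x} ≤ 1`) and `𝓘_x ≠ 0`, admits a resolution in the
  sense of BGMW Def. 3.1.3 (`CentreSeq.IsResolutionOf`). No hypothesis on the characteristic.

## Sources

* J. Kollár, *Lectures on Resolution of Singularities* (2007): Thm. 3.69, 3.70 ("We can start the
  induction with the case `dim X = 0`"), 3.111 Step 1. [Kollar2007]
* E. Bierstone, D. Grigoriev, P. Milman, J. Włodarczyk, arXiv:1206.3090: Def. 3.1.3, §3.2.
  [BierstoneGrigorievMilmanWlodarczyk2011]
-/

noncomputable section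

open CategoryTheory CategoryTheory.Limits AlgebraicGeometry TopologicalSpace IsLocalRing
  Scheme.IdealSheafData

namespace Literature.AlgebraicGeometry.Resolution

universe u

variable {X : Scheme.{u}}

/-! ## Termination: the sum of the orders over the support drops -/

section Measure

variable [IsLocallyNoetherian X] {M : MarkedIdeal X} {x : X} (hx : IsClosed ({x} : Set X))
  (hsnc : HasSNC M.boundary) (hμ : 1 ≤ M.mult) (hxM : x ∈ M.support)
  (hJ : stalkIdeal M.ideal x ≠ ⊥) {u : X.presheaf.stalk x}
  (hu : maximalIdeal (X.presheaf.stalk x) = Ideal.span {u})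

include hsnc hμ hxM hJ hu

/-- The support of the transform is finite if the support is (it lies over it, the blowing up
being injective). [cite: BierstoneGrigorievMilmanWlodarczyk2011, §3.2] -/
theorem finite_support_transform_point (hfin : M.support.Finite) :
    (M.transform (blowup.π (vanishingIdeal ⟨{x}, hx⟩)) (vanishingIdeal ⟨{x}, hx⟩)).support.Finite := by
  haveI := isIso_blowupπ_point hx hsnc hμ hxM hJ hu
  have hinj : Function.Injective (blowup.π (vanishingIdeal ⟨{x}, hx⟩)) := (blowup.π (vanishingIdeal ⟨{x}, hx⟩)).isOpenEmbedding.injective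
  exact (hfin.preimage hinj.injOn).subset (support_transform_point_subset hx hsnc hμ hxM hJ hu)

/-- **Termination measure.** Along the blowing up of a closed point `x` of the (finite) support,
the sum over the support of the orders `Σ_{z ∈ supp} ord_z 𝓘` strictly decreases (all orders being
finite: non-zero stalks): every point of the new support lies over a point of the old one with no
larger order, and over `x` the order drops by `μ ≥ 1` (or the point leaves the support).
[cite: Kollar2007, 3.111 Step 1; BierstoneGrigorievMilmanWlodarczyk2011, §3.2] -/
theorem sum_idealOrder_transform_point_lt (hfin : M.support.Finite)
    (hne : ∀ z ∈ M.support, stalkIdeal M.ideal z ≠ ⊥)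
    (hfin' : (M.transform (blowup.π (vanishingIdeal ⟨{x}, hx⟩)) (vanishingIdeal ⟨{x}, hx⟩)).support.Finite) :
    (hfin'.toFinset.sum fun z' =>
        (idealOrder (M.transform (blowup.π (vanishingIdeal ⟨{x}, hx⟩))
          (vanishingIdeal ⟨{x}, hx⟩)).ideal z').toNat) <
      hfin.toFinset.sum fun z => (idealOrder M.ideal z).toNat := by
  classical
  haveI := isIso_blowupπ_point hx hsnc hμ hxM hJ hu
  have hinj : Function.Injective (blowup.π (vanishingIdeal ⟨{x}, hx⟩)) := (blowup.π (vanishingIdeal ⟨{x}, hx⟩)).isOpenEmbedding.injective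
  set M' := M.transform (blowup.π (vanishingIdeal ⟨{x}, hx⟩)) (vanishingIdeal ⟨{x}, hx⟩) with hM'
  set S := hfin.toFinset with hS
  set S' := hfin'.toFinset with hS'
  -- every point of `S'` lies over a point of `S`, with no larger (finite) order
  have hover : ∀ z' ∈ S', (blowup.π (vanishingIdeal ⟨{x}, hx⟩)) z' ∈ S := fun z' hz' =>
    hfin.mem_toFinset.mpr (support_transform_point_subset hx hsnc hμ hxM hJ hu (hfin'.mem_toFinset.mp hz'))
  have hfinord : ∀ z ∈ S, idealOrder M.ideal z ≠ ⊤ := fun z hz =>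
    (idealOrder_lt_top_of_stalkIdeal_ne_bot (hne z (hfin.mem_toFinset.mp hz))).ne
  have hle : ∀ z' ∈ S', (idealOrder M'.ideal z').toNat ≤ (idealOrder M.ideal ((blowup.π (vanishingIdeal ⟨{x}, hx⟩)) z')).toNat :=
    fun z' hz' => ENat.toNat_le_toNat (idealOrder_transform_point_le hx hsnc hμ hxM hJ hu z')
      (hfinord _ (hover z' hz'))
  have himage : (S'.image (blowup.π (vanishingIdeal ⟨{x}, hx⟩))).sum (fun z => (idealOrder M.ideal z).toNat) =
      S'.sum fun z' => (idealOrder M.ideal ((blowup.π (vanishingIdeal ⟨{x}, hx⟩)) z')).toNat :=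
    Finset.sum_image fun a _ b _ h => hinj h
  have hsub : S'.image (blowup.π (vanishingIdeal ⟨{x}, hx⟩)) ⊆ S := Finset.image_subset_iff.mpr hover
  by_cases hcase : ∃ z' ∈ S', (blowup.π (vanishingIdeal ⟨{x}, hx⟩)) z' = x
  · -- the point over `x` is still in the support: its order dropped strictly
    obtain ⟨x', hx'S, hx'x⟩ := hcase
    have hlt : (idealOrder M'.ideal x').toNat < (idealOrder M.ideal ((blowup.π (vanishingIdeal ⟨{x}, hx⟩)) x')).toNat := by
      have h := idealOrder_transform_point_lt hx hsnc hμ hxM hJ hu x' hx'x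
      have htop : idealOrder M.ideal x ≠ ⊤ := by
        have := hfinord _ (hover x' hx'S); rwa [hx'x] at this
      obtain ⟨b, hb⟩ := ENat.ne_top_iff_exists.mp htop
      obtain ⟨c, hc⟩ := ENat.ne_top_iff_exists.mp (h.trans_le le_top).ne
      rw [hx'x, ← hb, ← hc, ENat.toNat_coe, ENat.toNat_coe]
      rw [← hb, ← hc] at h
      exact ENat.coe_lt_coe.mp h
    calc S'.sum (fun z' => (idealOrder M'.ideal z').toNat)
        < S'.sum fun z' => (idealOrder M.ideal ((blowup.π (vanishingIdeal ⟨{x}, hx⟩)) z')).toNat :=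
          Finset.sum_lt_sum hle ⟨x', hx'S, hlt⟩
      _ = (S'.image (blowup.π (vanishingIdeal ⟨{x}, hx⟩))).sum (fun z => (idealOrder M.ideal z).toNat) := himage.symm
      _ ≤ S.sum fun z => (idealOrder M.ideal z).toNat := Finset.sum_le_sum_of_subset hsub
  · -- the point over `x` left the support: the term `ord_x 𝓘 ≥ μ ≥ 1` disappeared
    push Not at hcase
    have hsub' : S'.image (blowup.π (vanishingIdeal ⟨{x}, hx⟩)) ⊆ S.erase x := by
      intro z hz
      obtain ⟨z', hz', rfl⟩ := Finset.mem_image.mp hz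
      exact Finset.mem_erase.mpr ⟨hcase z' hz', hover z' hz'⟩
    have hxS : x ∈ S := hfin.mem_toFinset.mpr hxM
    have hpos : 0 < (idealOrder M.ideal x).toNat := by
      obtain ⟨b, hb⟩ := ENat.ne_top_iff_exists.mp (hfinord x hxS)
      rw [← hb, ENat.toNat_coe]
      have h := hxM
      rw [MarkedIdeal.support, Set.mem_setOf_eq, ← hb] at h
      have := ENat.coe_le_coe.mp h
      omega
    calc S'.sum (fun z' => (idealOrder M'.ideal z').toNat)
        ≤ S'.sum fun z' => (idealOrder M.ideal ((blowup.π (vanishingIdeal ⟨{x}, hx⟩)) z')).toNat := Finset.sum_le_sum hle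
      _ = (S'.image (blowup.π (vanishingIdeal ⟨{x}, hx⟩))).sum (fun z => (idealOrder M.ideal z).toNat) := himage.symm
      _ ≤ (S.erase x).sum fun z => (idealOrder M.ideal z).toNat := Finset.sum_le_sum_of_subset hsub'
      _ < S.sum fun z => (idealOrder M.ideal z).toNat := Finset.sum_erase_lt_of_pos hxS hpos

end Measure

/-! ## Order reduction in dimension one -/

section Main

/-- The induction on the termination measure. [cite: Kollar2007, Thm. 3.69 with 3.70 and 3.111 Step 1] -/
theorem exists_isResolutionOf_of_dim_one_aux :
    ∀ (n : ℕ) {X : Scheme.{u}} [IsLocallyNoetherian X] (M : MarkedIdeal X)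
      (hfin : M.support.Finite),
      (hfin.toFinset.sum fun z => (idealOrder M.ideal z).toNat) ≤ n → 1 ≤ M.mult →
      HasSNC M.boundary → (∀ x ∈ M.support, IsClosed ({x} : Set X)) →
      (∀ x ∈ M.support, ∃ u : X.presheaf.stalk x,
        maximalIdeal (X.presheaf.stalk x) = Ideal.span {u}) →
      (∀ x ∈ M.support, stalkIdeal M.ideal x ≠ ⊥) →
      ∃ s : CentreSeq X, s.IsResolutionOf M := by
  intro n
  induction n with
  | zero =>
    intro X _ M hfin hle hμ hsnc hcl hpr hne
    refine ⟨CentreSeq.nil X, (CentreSeq.isResolutionOf_nil_iff M).mpr ?_⟩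
    by_contra hS
    obtain ⟨x, hxM⟩ := Set.nonempty_iff_ne_empty.mpr hS
    have hxS : x ∈ hfin.toFinset := hfin.mem_toFinset.mpr hxM
    have hpos : 0 < (idealOrder M.ideal x).toNat := by
      obtain ⟨b, hb⟩ := ENat.ne_top_iff_exists.mp
        (idealOrder_lt_top_of_stalkIdeal_ne_bot (hne x hxM)).ne
      rw [← hb, ENat.toNat_coe]
      have h := hxM
      rw [MarkedIdeal.support, Set.mem_setOf_eq, ← hb] at h
      have := ENat.coe_le_coe.mp h
      omega
    have := Finset.single_le_sum (f := fun z => (idealOrder M.ideal z).toNat)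
      (fun _ _ => Nat.zero_le _) hxS
    omega
  | succ n ih =>
    intro X _ M hfin hle hμ hsnc hcl hpr hne
    by_cases hS : M.support = ∅
    · exact ⟨CentreSeq.nil X, (CentreSeq.isResolutionOf_nil_iff M).mpr hS⟩
    obtain ⟨x, hxM⟩ := Set.nonempty_iff_ne_empty.mpr hS
    have hx : IsClosed ({x} : Set X) := hcl x hxM
    obtain ⟨u, hu⟩ := hpr x hxM
    have hJ := hne x hxM
    haveI : IsLocallyNoetherian (blowup (vanishingIdeal ⟨{x}, hx⟩)) := CentreSeq.isLocallyNoetherian_blowup _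
    haveI := isIso_blowupπ_point hx hsnc hμ hxM hJ hu
    have hfin' : (M.transform (blowup.π (vanishingIdeal ⟨{x}, hx⟩)) (vanishingIdeal ⟨{x}, hx⟩)).support.Finite :=
      finite_support_transform_point hx hsnc hμ hxM hJ hu hfin
    have hover : (M.transform (blowup.π (vanishingIdeal ⟨{x}, hx⟩)) (vanishingIdeal ⟨{x}, hx⟩)).support ⊆ (blowup.π (vanishingIdeal ⟨{x}, hx⟩)) ⁻¹' M.support :=
      support_transform_point_subset hx hsnc hμ hxM hJ hu
    have hlt := sum_idealOrder_transform_point_lt hx hsnc hμ hxM hJ hu hfin hne hfin'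
    obtain ⟨s', hs'⟩ := ih (M.transform (blowup.π (vanishingIdeal ⟨{x}, hx⟩)) (vanishingIdeal ⟨{x}, hx⟩)) hfin' (by omega) (by simpa using hμ)
      (M.hasSNC_transform_boundary (hsnc.hasSNCWith_vanishingIdeal_singleton hx) (blowup.isBlowup _))
      (fun y' hy' => isClosed_singleton_of_point hx hsnc hμ hxM hJ hu y' (hcl _ (hover hy')))
      (fun y' hy' => by
        obtain ⟨v, hv⟩ := hpr _ (hover hy')
        exact ⟨_, maximalIdeal_eq_span_of_point hx hsnc hμ hxM hJ hu y' hv⟩)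
      (fun y' hy' => stalkIdeal_transform_point_ne_bot hx hsnc hμ hxM hJ hu y' (hne _ (hover hy')))
    refine ⟨CentreSeq.cons (vanishingIdeal ⟨{x}, hx⟩) s', ?_, ?_⟩
    · exact (isAdmissibleFor_cons_vanishingIdeal_singleton_iff M hx hsnc hxM s').mpr hs'.1
    · rw [CentreSeq.transformMarked_cons]
      exact hs'.2

/-- **Order reduction for marked ideals in dimension one (every characteristic).** On a locally
Noetherian scheme `X`, a marked ideal `M = (X, 𝓘, E, μ)` with `μ ≥ 1`, `E` a simple normal
crossing boundary (so `X` is regular), and FINITE support `supp(𝓘, μ) = {x | ord_x 𝓘 ≥ μ}`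
consisting of closed points `x` at which the maximal ideal `𝔪_x` is principal (the
one-dimensional points) and `𝓘_x ≠ 0`, admits a resolution in the sense of BGMW Def. 3.1.3
(`CentreSeq.IsResolutionOf`: admissible regular centres inside the supports, simple normal
crossings with the boundaries, final support empty) — namely a sequence of blowings up of
closed points of the successive supports, each an isomorphism of schemes lowering
`Σ_{x ∈ supp} ord_x 𝓘`. This is the case `dim X = 1` of Kollár's Thm. 3.69 (order reduction for
marked ideals), where every component of the cosupport has codimension one (3.111 Step 1) and
no derivative — hence no hypothesis on the characteristic — enters.
[cite: Kollar2007, Thm. 3.69, 3.70, 3.111 Step 1] [cite: BierstoneGrigorievMilmanWlodarczyk2011, Def. 3.1.3] -/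
theorem exists_isResolutionOf_of_dim_one {X : Scheme.{u}} [IsLocallyNoetherian X]
    (M : MarkedIdeal X) (hμ : 1 ≤ M.mult) (hsnc : HasSNC M.boundary) (hfin : M.support.Finite)
    (hcl : ∀ x ∈ M.support, IsClosed ({x} : Set X))
    (hpr : ∀ x ∈ M.support, ∃ u : X.presheaf.stalk x,
      maximalIdeal (X.presheaf.stalk x) = Ideal.span {u})
    (hne : ∀ x ∈ M.support, stalkIdeal M.ideal x ≠ ⊥) :
    ∃ s : CentreSeq X, s.IsResolutionOf M :=
  exists_isResolutionOf_of_dim_one_aux _ M hfin le_rfl hμ hsnc hcl hpr hne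

/-- The same with the one-dimensionality stated through regular local rings of dimension `≤ 1` at
the points of the support (`𝔪_x` is then generated by `dim 𝒪_{X,x} ≤ 1` elements).
[cite: Kollar2007, Thm. 3.69, 3.70] -/
theorem exists_isResolutionOf_of_ringKrullDim_le_one {X : Scheme.{u}} [IsLocallyNoetherian X]
    (M : MarkedIdeal X) (hμ : 1 ≤ M.mult) (hsnc : HasSNC M.boundary) (hfin : M.support.Finite)
    (hcl : ∀ x ∈ M.support, IsClosed ({x} : Set X))
    (hdim : ∀ x ∈ M.support, ringKrullDim (X.presheaf.stalk x) ≤ 1)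
    (hne : ∀ x ∈ M.support, stalkIdeal M.ideal x ≠ ⊥) :
    ∃ s : CentreSeq X, s.IsResolutionOf M := by
  refine exists_isResolutionOf_of_dim_one M hμ hsnc hfin hcl (fun x hx => ?_) hne
  obtain ⟨hregx, u, hu, -, -⟩ := hsnc x
  -- `𝔪_x` is generated by `spanFinrank 𝔪_x = dim 𝒪_{X,x} ≤ 1` elements
  have hd : (maximalIdeal (X.presheaf.stalk x)).spanFinrank ≤ 1 := by
    have h := hdim x hx
    rw [← hregx.spanFinrank_maximalIdeal] at h
    exact_mod_cast h
  generalize hr : (maximalIdeal (X.presheaf.stalk x)).spanFinrank = r at u hd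
  interval_cases r
  · refine ⟨0, ?_⟩
    rw [Ideal.span_singleton_zero, ← hu, Ideal.span_eq_bot]
    rintro _ ⟨i, rfl⟩
    exact i.elim0
  · exact ⟨u 0, by rw [← hu, Set.range_unique]; rfl⟩

end Main

end Literature.AlgebraicGeometry.Resolution

end
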